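import Mathlib
import HarnessLib
import Summits.HubbardSuperconductivity.HubbardSuperconductivity.Theorems.KLProgrammeKLRegimeEngineV8PairTransferRelDefs

/-!
# Route `KLProgramme` — ENGINE child gen 8 (stmt-HubbardSuperconductivity-20437 `KLRegimeEngineV17F2`), skeleton v2 class #5 «(S)-transfer» rev 3 (RELATIVE family):
# the ONE instantiation of the relative bar — `klRelGain`, `transferBarRelAtW`, `transferBarRelAt`, and the INHERITANCE-ROOM lemma `transferBarRelAtW_succ_room`
# (cell gate-hubbard-kl, seat hubbard-kl-k3c1-p1 g10; plan g20 (R54i): «the Props are bar-parametric, so any later G question lives in ONE instantiation def»)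

WHY (CLASS5-DEFECT-BUDGET-2 e1cd66a0d1607802 §2–§3).  The relative step door (`kltc_relative_step_fwd`, p584594) re-charges the inherited relative residue with
coefficient 1; the induction closes iff the bar of a FIXED symbol difference grows along the ladder by more than the per-slice relative source.  With the soft mass as
the unit (`klSoftMass_succ`: ×4 per step) every slot whose shape shrinks by LESS than 4 per step has room; the two shapes of `klEngGeo8.phGain` that shrink by exactly 4
(the `ρ = 0` floor `4^{−n}` and the frozen branch `Λₙ/ρ`) have none.  This file therefore builds the relative bar from DERIVED profiles only — no `G.phGain` inside — so
that NO ratio-4 window exists: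
* §1 **`klRelGain n ρ := min(ρ/Λₙ, Λₙ/ρ)·(1 + kₙ(ρ))`** (`kₙ = klShellCount`: the number of hard shells below the transfer).  Near regime `ρ < Λₙ`: `ρ/Λₙ` (the `Kρ4ⁿ` shape);
  at `ρ ≍ Λₙ`: `O(1)`; frozen `ρ ≫ Λₙ`: `(Λₙ/ρ)·(1 + log₄(ρ/Λₙ))` — the one-loop mixed particle–hole bubble of all hard shells against a soft line ACCUMULATES one unit
  `≍ Λ_soft/ρ` per hard shell below `ρ` (crossing strips; CLASS5-DEFECT-BUDGET-2 §3), which is what the factor `1 + kₙ` books; `klRelGain n 0 = 0` (the `ρ = 0` floor is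
  carried by the born-overlap weight instead).  **`klRelGain_succ_room`**: `klRelGain n ρ + min(ρ/Λₙ₊₁, Λₙ₊₁/ρ) ≤ 4·klRelGain (n+1) ρ` — after the ×4 of the mass, the
  inherited profile leaves at least ONE per-shell unit of room at the new scale, at every transfer.
* §2 **`transferBarRelAtW G P r β U n ms ov Qm k k′ := r·{(KlamU)²·[(klRelGain n ρ_d + klRelGain n ρ_x + 2^{−n} + 1/L)·ms + ov] + [(Klam|U|)³2^{−n} + thermalBar n]·ms}`**
  (`ρ_d = |k−k′|_𝕋`, `ρ_x = |k+k′−Qm|_𝕋`; `ms`, `ov` = the soft mass and the born overlap of the symbol difference, passed as numbers), `_nonneg`, `_mono`, and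
  **`transferBarRelAtW_succ_room`**: `bar(n, ms, 0) + r·{(KlamU)²[(unit(ρ_d) + unit(ρ_x) + 2^{−n} + 3/L)·ms + ov′] + [(Klam|U|)³2^{−n} + 3·thermalBar(n+1)]·ms} ≤ bar(n+1, 4ms, ov′)`
  — the slot-by-slot ROOM the (c) closer plugs into `kltc_relative_step_fwd`'s majorants (`R₀` = old bar of the history pair, whose born overlap at the old scale is `0`
  for a pair still admissible at the new scale; sources ≤ room).
* §3 **`transferBarRelAt G P r β U μ n ψ₁ ψ₂ := transferBarRelAtW … n (klSoftMass (Kₙ) n (ψ₁−ψ₂)) (klShellOverlap (Kₙ) n (ψ₁−ψ₂))`** — the `TB` of `PairTransferRelFamily`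
  (`…EngineV8PairTransferRelDefs`); symmetric in the pair; `= 0`-residue-compatible on the diagonal.
The CONSUMER bridge `transferBarRelAt n ψ 0 ≤ transferBarAt G … n` is ONE inequality on `G.phGain` (it must host `c₀·klRelGain`, `c₀·2^{−n}` and the overlap floor):
true for the frozen-branch-amended package of located risk #15 (β′) (plan g20 (R54i)), and for `klEngGeo8` exactly up to that risk's shell-count factor — it is NOT
asserted here (the bridge lemma `pairTransferPinnedAt_of_rel` takes it as a hypothesis).  Definitions + real arithmetic; nothing about the model is asserted.  0 kit.
-/

noncomputable section

namespace Summit.HubbardSuperconductivity.HubbardSuperconductivity.Theorems.KLRegimeSplit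

set_option linter.dupNamespace false -- summit = problem name (single-conjunct summit), D-0017

open Real Finset Literature.MathematicalPhysics.QuantumLattice Literature.Probability.LatticeModels
open Summit.HubbardSuperconductivity.HubbardSuperconductivity.Theorems.KLProgrammeLegKernels
open Summit.HubbardSuperconductivity.HubbardSuperconductivity.Theorems.DispersionFlow

/-! ## §1 The relative gain profile and its inheritance room -/

section Gain

/-- The shell count grows by exactly the indicator of the new shell: `k_{n+1}(ρ) = kₙ(ρ) + [Λ_{n+1} ≤ ρ]`. -/
theorem klShellCount_succ (n : ℕ) (ρ : ℝ) :
    klShellCount (n + 1) ρ = klShellCount n ρ + (if klScale klE0 (n + 1) ≤ ρ then 1 else 0) := by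
  unfold klShellCount
  rw [Finset.range_add_one, Finset.filter_insert]
  split_ifs with h
  · rw [Finset.card_insert_of_notMem (by simp)]
  · simp

/-- **The relative gain profile** `klRelGain n ρ = min(ρ/Λₙ, Λₙ/ρ)·(1 + kₙ(ρ))`. -/
def klRelGain (n : ℕ) (ρ : ℝ) : ℝ := min (ρ / klScale klE0 n) (klScale klE0 n / ρ) * (1 + (klShellCount n ρ : ℝ))

/-- At zero transfer the profile vanishes (the floor is carried by the born overlap). -/
theorem klRelGain_zero (n : ℕ) : klRelGain n 0 = 0 := by simp [klRelGain]

/-- The profile is nonnegative for `0 ≤ ρ`. -/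
theorem klRelGain_nonneg (n : ℕ) {ρ : ℝ} (hρ : 0 ≤ ρ) : 0 ≤ klRelGain n ρ := by
  unfold klRelGain
  have hΛ : 0 < klScale klE0 n := klth_klScale_pos n
  refine mul_nonneg (le_min (div_nonneg hρ hΛ.le) (div_nonneg hΛ.le hρ)) (by positivity)

/-- The symmetric factor is at most `1`: `min(ρ/Λ, Λ/ρ) ≤ 1` (`0 < Λ`, `0 ≤ ρ`). -/
theorem min_div_div_le_one {Λ ρ : ℝ} (hΛ : 0 < Λ) : min (ρ / Λ) (Λ / ρ) ≤ 1 := by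
  rcases le_or_gt ρ Λ with h | h
  · exact (min_le_left _ _).trans ((div_le_one hΛ).mpr h)
  · have hρ0 : 0 < ρ := hΛ.trans h
    exact (min_le_right _ _).trans ((div_le_one hρ0).mpr h.le)

/-- Crude size: `klRelGain n ρ ≤ n + 2`. -/
theorem klRelGain_le (n : ℕ) (ρ : ℝ) : klRelGain n ρ ≤ n + 2 := by
  unfold klRelGain
  have hΛ : 0 < klScale klE0 n := klth_klScale_pos n
  have h1 := min_div_div_le_one (ρ := ρ) hΛ
  have hk : (klShellCount n ρ : ℝ) ≤ n + 1 := by exact_mod_cast klShellCount_le n ρ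
  have h2 : 0 ≤ 1 + (klShellCount n ρ : ℝ) := by positivity
  nlinarith

/-- **INHERITANCE ROOM of the relative gain**: `klRelGain n ρ + min(ρ/Λₙ₊₁, Λₙ₊₁/ρ) ≤ 4·klRelGain (n+1) ρ` for every `ρ ≥ 0` — after the soft mass of a fixed symbol has
quadrupled, the inherited profile leaves at least one per-shell unit `min(ρ/Λₙ₊₁, Λₙ₊₁/ρ)` of room at the new scale (three regimes: `ρ < Λₙ₊₁`, `Λₙ₊₁ ≤ ρ < Λₙ`, `Λₙ ≤ ρ`). -/
theorem klRelGain_succ_room (n : ℕ) {ρ : ℝ} (hρ : 0 ≤ ρ) :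
    klRelGain n ρ + min (ρ / klScale klE0 (n + 1)) (klScale klE0 (n + 1) / ρ) ≤ 4 * klRelGain (n + 1) ρ := by
  rcases hρ.eq_or_lt with h0 | hρ0
  · subst h0; simp [klRelGain]
  set Λ := klScale klE0 n with hΛdef
  have hΛ : 0 < Λ := klth_klScale_pos n
  have hΛ' : klScale klE0 (n + 1) = Λ / 4 := klth_klScale_succ n
  unfold klRelGain
  rw [klShellCount_succ, hΛ']
  rcases le_or_gt Λ ρ with h1 | h1
  · -- frozen at both scales: `Λ ≤ ρ`
    have hk : Λ / 4 ≤ ρ := by linarith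
    rw [if_pos hk]
    have hm : min (ρ / Λ) (Λ / ρ) = Λ / ρ := min_eq_right (by
      rw [div_le_div_iff₀ hρ0 hΛ]; nlinarith)
    have hm' : min (ρ / (Λ / 4)) (Λ / 4 / ρ) = Λ / 4 / ρ := min_eq_right (by
      rw [div_le_div_iff₀ hρ0 (by positivity)]; nlinarith)
    rw [hm, hm']
    push_cast
    have hk0 : (0 : ℝ) ≤ (klShellCount n ρ : ℝ) := by positivity
    have e : Λ / ρ * (1 + (klShellCount n ρ : ℝ)) + Λ / 4 / ρ - 4 * (Λ / 4 / ρ * (1 + ((klShellCount n ρ : ℝ) + 1))) = -(3 / 4) * (Λ / ρ) := by ring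
    have : 0 ≤ Λ / ρ := by positivity
    nlinarith
  · -- near at the old scale: `ρ < Λ`, so `kₙ(ρ) = 0`
    have hk0 : klShellCount n ρ = 0 := klShellCount_eq_zero_of_lt (by rw [← hΛdef]; exact h1)
    rw [hk0]
    have hm : min (ρ / Λ) (Λ / ρ) = ρ / Λ := min_eq_left (by
      rw [div_le_div_iff₀ hΛ hρ0]; nlinarith)
    rw [hm]
    rcases le_or_gt (Λ / 4) ρ with h2 | h2
    · -- `Λ/4 ≤ ρ < Λ`: the new shell is counted
      rw [if_pos h2]
      have hm' : min (ρ / (Λ / 4)) (Λ / 4 / ρ) = Λ / 4 / ρ := min_eq_right (by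
        rw [div_le_div_iff₀ hρ0 (by positivity)]; nlinarith)
      rw [hm']
      push_cast
      -- `ρ/Λ + Λ/(4ρ) ≤ 4·(Λ/(4ρ))·2 = 2Λ/ρ`
      have hρΛ : ρ / Λ ≤ 1 := (div_le_one hΛ).mpr h1.le
      have hΛρ : 1 ≤ Λ / ρ := (one_le_div hρ0).mpr h1.le
      have e : Λ / 4 / ρ = (Λ / ρ) / 4 := by ring
      rw [e]
      norm_num
      nlinarith
    · -- `ρ < Λ/4`: near at both scales
      rw [if_neg (not_le.mpr h2)]
      have hm' : min (ρ / (Λ / 4)) (Λ / 4 / ρ) = ρ / (Λ / 4) := min_eq_left (by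
        rw [div_le_div_iff₀ (by positivity) hρ0]; nlinarith)
      rw [hm']
      push_cast
      rw [show ρ / (Λ / 4) = 4 * (ρ / Λ) by field_simp]
      have : 0 ≤ ρ / Λ := by positivity
      norm_num
      nlinarith

end Gain

/-! ## §2 The relative bar on numeric weights and its inheritance room -/

section BarW

variable (L : ℕ)

/-- **The relative bar on numeric weights** `ms` (soft mass of the symbol difference at scale `n`) and `ov` (its born overlap at scale `n`):
`r·{(KlamU)²·[(klRelGain n ρ_d + klRelGain n ρ_x + 2^{−n} + 1/L)·ms + ov] + [(Klam|U|)³2^{−n} + thermalBar n]·ms}`. -/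
def transferBarRelAtW (G : GeoConsts) (P : SplitConsts) (r β U : ℝ) (n : ℕ) (ms ov : ℝ) (Qm k k' : TorusSite 2 L) : ℝ :=
  r * ((P.Klam * U) ^ 2 * ((klRelGain n (klTorusNorm L (k - k')) + klRelGain n (klTorusNorm L (k + k' - Qm)) + ((2 : ℝ) ^ n)⁻¹ + ((L : ℝ))⁻¹) * ms + ov) +
    ((P.Klam * |U|) ^ 3 * ((2 : ℝ) ^ n)⁻¹ + thermalBar G P U β n) * ms)

variable {L}

/-- `thermalBar` is nonnegative for `0 ≤ G.CF`. -/
theorem thermalBar_nonneg' {G : GeoConsts} (hCF : 0 ≤ G.CF) (P : SplitConsts) (U β : ℝ) (n : ℕ) : 0 ≤ thermalBar G P U β n := by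
  unfold thermalBar; positivity

/-- `thermalBar` is non-decreasing along the ladder (`0 ≤ G.CF`). -/
theorem thermalBar_le_succ {G : GeoConsts} (hCF : 0 ≤ G.CF) (P : SplitConsts) (U β : ℝ) (n : ℕ) : thermalBar G P U β n ≤ thermalBar G P U β (n + 1) := by
  unfold thermalBar
  refine mul_le_mul_of_nonneg_left (inv_anti₀ (by positivity) (pow_le_pow_right₀ (by norm_num) (by omega))) (by positivity)

/-- The relative bar is nonnegative (`0 ≤ r`, `0 ≤ P.Klam`, `0 ≤ G.CF`, `0 ≤ ms`, `0 ≤ ov`). -/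
theorem transferBarRelAtW_nonneg {G : GeoConsts} (hCF : 0 ≤ G.CF) {P : SplitConsts} (hK : 0 ≤ P.Klam) {r : ℝ} (hr : 0 ≤ r) (β U : ℝ) (n : ℕ) {ms ov : ℝ}
    (hms : 0 ≤ ms) (hov : 0 ≤ ov) (Qm k k' : TorusSite 2 L) : 0 ≤ transferBarRelAtW L G P r β U n ms ov Qm k k' := by
  unfold transferBarRelAtW
  have h1 := klRelGain_nonneg n ((show 0 ≤ klTorusNorm L (k - k') by unfold klTorusNorm; exact torusSupNorm_nonneg _))
  have h2 := klRelGain_nonneg n ((show 0 ≤ klTorusNorm L (k + k' - Qm) by unfold klTorusNorm; exact torusSupNorm_nonneg _))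
  have h3 := thermalBar_nonneg' hCF P U β n
  have h4 : 0 ≤ P.Klam * |U| := mul_nonneg hK (abs_nonneg _)
  positivity

/-- The relative bar is monotone in the two weights (`0 ≤ r`, `0 ≤ P.Klam`, `0 ≤ G.CF`). -/
theorem transferBarRelAtW_mono {G : GeoConsts} (hCF : 0 ≤ G.CF) {P : SplitConsts} (hK : 0 ≤ P.Klam) {r : ℝ} (hr : 0 ≤ r) (β U : ℝ) (n : ℕ)
    {ms ms' ov ov' : ℝ} (hms : ms ≤ ms') (hov : ov ≤ ov') (Qm k k' : TorusSite 2 L) :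
    transferBarRelAtW L G P r β U n ms ov Qm k k' ≤ transferBarRelAtW L G P r β U n ms' ov' Qm k k' := by
  unfold transferBarRelAtW
  have h1 := klRelGain_nonneg n ((show 0 ≤ klTorusNorm L (k - k') by unfold klTorusNorm; exact torusSupNorm_nonneg _))
  have h2 := klRelGain_nonneg n ((show 0 ≤ klTorusNorm L (k + k' - Qm) by unfold klTorusNorm; exact torusSupNorm_nonneg _))
  have h3 := thermalBar_nonneg' hCF P U β n
  have h4 : 0 ≤ P.Klam * |U| := mul_nonneg hK (abs_nonneg _)
  have hA : 0 ≤ (P.Klam * U) ^ 2 * (klRelGain n (klTorusNorm L (k - k')) + klRelGain n (klTorusNorm L (k + k' - Qm)) + ((2 : ℝ) ^ n)⁻¹ + ((L : ℝ))⁻¹) := by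
    positivity
  have hB : 0 ≤ (P.Klam * |U|) ^ 3 * ((2 : ℝ) ^ n)⁻¹ + thermalBar G P U β n := by positivity
  have hC : 0 ≤ (P.Klam * U) ^ 2 := by positivity
  refine mul_le_mul_of_nonneg_left ?_ hr
  nlinarith [mul_le_mul_of_nonneg_left hms hA, mul_le_mul_of_nonneg_left hov hC, mul_le_mul_of_nonneg_left hms hB]

/-- The relative bar is monotone in `r` (nonnegative weights). -/
theorem transferBarRelAtW_mono_r {G : GeoConsts} (hCF : 0 ≤ G.CF) {P : SplitConsts} (hK : 0 ≤ P.Klam) {r r' : ℝ} (hr : r ≤ r') (β U : ℝ) (n : ℕ)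
    {ms ov : ℝ} (hms : 0 ≤ ms) (hov : 0 ≤ ov) (Qm k k' : TorusSite 2 L) :
    transferBarRelAtW L G P r β U n ms ov Qm k k' ≤ transferBarRelAtW L G P r' β U n ms ov Qm k k' := by
  have h := transferBarRelAtW_nonneg (L := L) hCF hK zero_le_one β U n hms hov Qm k k'
  unfold transferBarRelAtW at h ⊢
  rw [one_mul] at h
  exact mul_le_mul_of_nonneg_right hr h

/-- **INHERITANCE ROOM of the relative bar (slot by slot).**  For a FIXED symbol difference (soft mass `ms` at scale `n`, hence `4·ms` at scale `n+1`; born overlap `0`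
at scale `n` — a pair still admissible at `n+1` does not meet the band of scale `n` — and `ov′ ≥ 0` at scale `n+1`):
`bar(n, ms, 0) + r·{(KlamU)²·[(u_{n+1}(ρ_d) + u_{n+1}(ρ_x) + 2^{−n} + 3/L)·ms + ov′] + [(Klam|U|)³·2^{−n} + 3·thermalBar(n+1)]·ms} ≤ bar(n+1, 4·ms, ov′)`,
`u_{n+1}(ρ) := min(ρ/Λₙ₊₁, Λₙ₊₁/ρ)` the per-shell unit — the room the per-slice relative sources must fit (`0 ≤ r`, `0 ≤ ms`, `0 ≤ G.CF`). -/
theorem transferBarRelAtW_succ_room {G : GeoConsts} (hCF : 0 ≤ G.CF) (P : SplitConsts) {r : ℝ} (hr : 0 ≤ r) (β U : ℝ) (n : ℕ) {ms : ℝ} (hms : 0 ≤ ms)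
    (ov' : ℝ) (Qm k k' : TorusSite 2 L) :
    transferBarRelAtW L G P r β U n ms 0 Qm k k' +
        r * ((P.Klam * U) ^ 2 *
              ((min (klTorusNorm L (k - k') / klScale klE0 (n + 1)) (klScale klE0 (n + 1) / klTorusNorm L (k - k')) +
                  min (klTorusNorm L (k + k' - Qm) / klScale klE0 (n + 1)) (klScale klE0 (n + 1) / klTorusNorm L (k + k' - Qm)) +
                  ((2 : ℝ) ^ n)⁻¹ + 3 * ((L : ℝ))⁻¹) * ms + ov') +
            ((P.Klam * |U|) ^ 3 * ((2 : ℝ) ^ n)⁻¹ + 3 * thermalBar G P U β (n + 1)) * ms) ≤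
      transferBarRelAtW L G P r β U (n + 1) (4 * ms) ov' Qm k k' := by
  -- the two gain slots
  have hg1 := klRelGain_succ_room n ((show 0 ≤ klTorusNorm L (k - k') by unfold klTorusNorm; exact torusSupNorm_nonneg _))
  have hg2 := klRelGain_succ_room n ((show 0 ≤ klTorusNorm L (k + k' - Qm) by unfold klTorusNorm; exact torusSupNorm_nonneg _))
  -- the thermal slot
  have hth := thermalBar_le_succ hCF P U β n
  -- `2^{−n} = 2·2^{−(n+1)}`
  have h2 : ((2 : ℝ) ^ n)⁻¹ = 2 * ((2 : ℝ) ^ (n + 1))⁻¹ := by rw [pow_succ]; field_simp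
  unfold transferBarRelAtW
  rw [h2, ← mul_add]
  refine mul_le_mul_of_nonneg_left ?_ hr
  have hU2 : 0 ≤ (P.Klam * U) ^ 2 := by positivity
  have hA := mul_le_mul_of_nonneg_left hg1 (mul_nonneg hU2 hms)
  have hB := mul_le_mul_of_nonneg_left hg2 (mul_nonneg hU2 hms)
  have hT := mul_le_mul_of_nonneg_left hth hms
  nlinarith [hA, hB, hT]

end BarW

/-! ## §3 The symbol-level instantiation: the `TB` of `PairTransferRelFamily` -/

section Bar

variable (L M : ℕ) [NeZero L] [NeZero M]

/-- **`transferBarRelAt G P r β U μ n ψ₁ ψ₂ Qm k k′`** — the relative bar of the pair `(ψ₁ | ψ₂)` at scale `n`: `transferBarRelAtW` at the soft mass and the born overlap of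
`ψ₁ − ψ₂` at the flowing frame `Kₙ`.  This is the `TB` the class-#5 rev-3 step Prop instantiates `PairTransferRelFamily … n TB` with. -/
def transferBarRelAt (G : GeoConsts) (P : SplitConsts) (r β U μ : ℝ) (n : ℕ) (ψ₁ ψ₂ : FreqMomentum L M → ℝ) (Qm k k' : TorusSite 2 L) : ℝ :=
  transferBarRelAtW L G P r β U n (klSoftMass L M β μ (klFlowFrameU L M β U μ n) n (ψ₁ - ψ₂))
    (klShellOverlap L M β μ (klFlowFrameU L M β U μ n) n (ψ₁ - ψ₂)) Qm k k'

variable {L M}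

/-- The relative bar is symmetric in the pair. -/
theorem transferBarRelAt_comm (G : GeoConsts) (P : SplitConsts) (r β U μ : ℝ) (n : ℕ) (ψ₁ ψ₂ : FreqMomentum L M → ℝ) (Qm k k' : TorusSite 2 L) :
    transferBarRelAt L M G P r β U μ n ψ₁ ψ₂ Qm k k' = transferBarRelAt L M G P r β U μ n ψ₂ ψ₁ Qm k k' := by
  unfold transferBarRelAt
  rw [klSoftMass_sub_comm]
  congr 1
  unfold klShellOverlap
  congr 1
  refine sum_congr rfl fun x _ => ?_
  rw [Pi.sub_apply, Pi.sub_apply, abs_sub_comm]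

/-- The relative bar is nonnegative (`0 < β`, `0 ≤ r`, `0 ≤ P.Klam`, `0 ≤ G.CF`). -/
theorem transferBarRelAt_nonneg {G : GeoConsts} (hCF : 0 ≤ G.CF) {P : SplitConsts} (hK : 0 ≤ P.Klam) {r : ℝ} (hr : 0 ≤ r) {β : ℝ} (hβ : 0 < β) (U μ : ℝ)
    (n : ℕ) (ψ₁ ψ₂ : FreqMomentum L M → ℝ) (Qm k k' : TorusSite 2 L) : 0 ≤ transferBarRelAt L M G P r β U μ n ψ₁ ψ₂ Qm k k' :=
  transferBarRelAtW_nonneg hCF hK hr β U n (klSoftMass_nonneg β μ _ hβ n _) (klShellOverlap_nonneg β μ _ hβ n _) Qm k k'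

/-- On the DIAGONAL the bar vanishes: `transferBarRelAt … n ψ ψ = 0` (the relative clause is exact there, `PairTransferRelAt.refl`). -/
theorem transferBarRelAt_self (G : GeoConsts) (P : SplitConsts) (r β U μ : ℝ) (n : ℕ) (ψ : FreqMomentum L M → ℝ) (Qm k k' : TorusSite 2 L) :
    transferBarRelAt L M G P r β U μ n ψ ψ Qm k k' = 0 := by
  unfold transferBarRelAt transferBarRelAtW
  have h0 : ψ - ψ = fun _ => (0 : ℝ) := by funext x; simp
  rw [h0, klSoftMass_zero]
  have hov : klShellOverlap L M β μ (klFlowFrameU L M β U μ n) n (fun _ => (0 : ℝ)) = 0 := by simp [klShellOverlap]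
  rw [hov]
  ring

end Bar

end Summit.HubbardSuperconductivity.HubbardSuperconductivity.Theorems.KLRegimeSplit

end
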